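import Summits.CriticalPhenomena.SAWScalingLimit.Theorems.SAWDefectDecoherenceObservableToSLERCarvedReductionSqueezeTwoPieceEscape
import Summits.CriticalPhenomena.SAWScalingLimit.Theorems.SAWDevelopingMapObservableToSLECanonicalTransferAdmissibleBits
import HarnessLib

/-!
# Two-piece flat domains: the inner vertex domain at a fixed mesh
# (piece (G4′c) of stub 5a4′ `stub_carvedReduction_squeeze`)

Piece of stub 5a4′ `stub_carvedReduction_squeeze` (`TwoPieceAdmRestrictionLimit → MovingCarvingSqueeze`)
of the line `bridge-gate-renewal` (r9) of the crux `SAWDefectDecoherence.ObservableToSLER`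
(stmt-CriticalPhenomena-14005; twin T2b′/T2b″ of stmt-CriticalPhenomena-10472), item (G4′):
admissible lattice families of a TWO-PIECE FLAT domain (see `…SqueezeTwoPiecePush`,
`…SqueezeTwoPieceEscape`).  At a fixed mesh `δ`, for a bounded `Ω` with connected exterior whose
frontier is `∂Ω`, flat in the `ρ`-balls about `p 0`, `p 1`, and prescribed threshold rows `m i`
(up-faces of row `m i` above the line `im = im (p i)` by at most `ρ/16`), the deep vertices are
`S = {u | δ c_u ∈ Ω, (δ c_u ∈ B(p i, ρ/2) → m i ≤ row u), B̄(δ c_u, 70δ) ⊆ Ω ∪ B(p 0, 5ρ/8) ∪ B(p 1, 5ρ/8)}`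
and the inner domain is the FILL (`FloorRatio.exists_fill`) of the `S`-component `G` of a base
vertex `v₀` with respect to the far set `{‖·‖ ≥ R + ρ + 5δ}`:

* `exists_twoPieceInner` — the fill `Λ` is a finite, SIMPLY CONNECTED, CONNECTED vertex set
  containing `G`, all of whose vertices have `δ c_z ∈ Ω` (vertices outside `Ω` escape around
  `G`, `exists_pathIn_far_of_not_mem`), whose vertices in `B(p i, ρ/16)` have row `≥ m i`
  (`exists_pathIn_far_of_row_lt`), with its fill characterisation (for monotonicity,
  `FloorRatio.fill_mono`);
* `pathIn_of_near_window` — conversely, once the target disc `B̄(p i + iρ/4, ρ/8)` is joined to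
  `v₀` inside `S`, every vertex of `B(p i, ρ/16)` of row `≥ m i` is in `G` (greedy ascent by
  `ρ/4` through deep vertices): EXACT ROWS near the windows;
* `mem_deep_of_closedBall_subset` — a vertex whose closed `r`-disc lies in `Ω`,
  `r ≥ 70δ` and `r ≥ (m i + 1/3) δ√3/2 - im (p i)`, is deep (used with the exhaustion of
  compacts by deep walks, `FloorRatio.exists_walk_deep_of_isCompact`).

Sources: H. Duminil-Copin, S. Smirnov, Ann. of Math. 175 (2012) §3; G. F. Lawler, O. Schramm,
W. Werner, Proc. Sympos. Pure Math. 72 (2004) §3.4.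
-/

noncomputable section

open scoped Topology
open Filter Set Metric
open Literature.Probability.LatticeModels (HexVertex hexGraph hexCenter Site)
open Literature.Probability.RandomPlanarGeometry
open Literature.Probability.RandomPlanarGeometry.SAW
open Literature.Probability.Percolation (PathIn)

namespace Summit.CriticalPhenomena.SAWScalingLimit.Theorems.ObservableToSLER.Squeeze

open Summit.CriticalPhenomena.SAWScalingLimit.Theorems.ObservableToSLE.FloorRatio
open Summit.CriticalPhenomena.SAWScalingLimit.Theorems.ObservableToSLE.Negative
  (finite_embMeshVertices_hex)

/-- **The inner vertex domain of a two-piece flat domain at a fixed mesh.**  See the module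
docstring: the fill `Λ` of the `S`-component of `v₀` is finite, simply connected and connected,
contains that component, lies inside `Ω`, and has rows `≥ m i` inside `B(p i, ρ/16)`. -/
theorem exists_twoPieceInner {Ω : Set ℂ} {ρ δ R : ℝ} {p : Fin 2 → ℂ} {m : Fin 2 → ℤ}
    {S : Set HexVertex}
    (hE : IsConnected (closure Ω)ᶜ) (hEfr : frontier (closure Ω)ᶜ = frontier Ω)
    (hΩR : ∀ z ∈ Ω, ‖z‖ < R)
    (hfl : ∀ i, Ω ∩ ball (p i) ρ = {z : ℂ | (p i).im < z.im} ∩ ball (p i) ρ)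
    (hsep : 2 * ρ ≤ dist (p 0) (p 1)) (hρ : 0 < ρ) (hδ : 0 < δ) (hδρ : 1000 * δ ≤ ρ)
    (hm : ∀ i, ((m i : ℝ) + 1 / 3) * (δ * (Real.sqrt 3 / 2)) ≤ (p i).im + ρ / 16)
    (hS : ∀ u, u ∈ S ↔ ((δ : ℂ) * hexCenter u ∈ Ω ∧
      (∀ i, (δ : ℂ) * hexCenter u ∈ ball (p i) (ρ / 2) → m i ≤ u.1 1) ∧
      closedBall ((δ : ℂ) * hexCenter u) (70 * δ) ⊆ Ω ∪ ball (p 0) (5 * ρ / 8) ∪ ball (p 1) (5 * ρ / 8)))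
    (v₀ : HexVertex) :
    ∃ Λ : Finset HexVertex, hexDomainSimplyConnected Λ ∧
      (hexGraph.induce (↑Λ : Set HexVertex)).Preconnected ∧
      (∀ z : HexVertex, PathIn hexGraph S v₀ z → z ∈ Λ) ∧
      (∀ z ∈ Λ, (δ : ℂ) * hexCenter z ∈ Ω) ∧
      (∀ z ∈ Λ, ∀ i, dist ((δ : ℂ) * hexCenter z) (p i) < ρ / 16 → m i ≤ z.1 1) ∧
      (∀ z : HexVertex, z ∈ Λ ↔ ¬ ∃ w : HexVertex, R + ρ + 5 * δ ≤ ‖(δ : ℂ) * hexCenter w‖ ∧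
        PathIn hexGraph {x | PathIn hexGraph S v₀ x}ᶜ z w) := by
  have hR : 0 ≤ R := by
    have hc := center_mem_closure_of_flat hρ (hfl 0)
    obtain ⟨z, hz, -⟩ := Metric.mem_closure_iff.1 hc 1 one_pos
    exact (norm_nonneg z).trans (hΩR z hz).le
  set G : Set HexVertex := {x | PathIn hexGraph S v₀ x} with hG
  set F : Set HexVertex := {w | R + ρ + 5 * δ ≤ ‖(δ : ℂ) * hexCenter w‖} with hF
  have hS' : ∀ u ∈ S, (δ : ℂ) * hexCenter u ∈ Ω ∧
      closedBall ((δ : ℂ) * hexCenter u) (70 * δ) ⊆ Ω ∪ ball (p 0) (5 * ρ / 8) ∪ ball (p 1) (5 * ρ / 8) :=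
    fun u hu => ⟨((hS u).1 hu).1, ((hS u).1 hu).2.2⟩
  have hSrow : ∀ u ∈ S, ∀ i, (δ : ℂ) * hexCenter u ∈ ball (p i) (ρ / 2) → m i ≤ u.1 1 :=
    fun u hu => ((hS u).1 hu).2.1
  have hGS : G ⊆ S := fun x hx => hx.right_mem
  have hGnorm : ∀ x ∈ G, ‖(δ : ℂ) * hexCenter x‖ < R + ρ := fun x hx => by
    have := hΩR _ (hS' x (hGS hx)).1; linarith
  -- `G` is connected through itself
  have hGG : ∀ x ∈ G, ∀ y ∈ G, PathIn hexGraph G x y := fun x hx y hy =>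
    (pathIn_component (hx.symm.trans hy)).mono fun u hu => hx.trans hu
  -- the far set has finite complement
  have hfin : Fᶜ.Finite := by
    refine (finite_embMeshVertices_hex (isBounded_ball (x := (0 : ℂ)) (r := R + ρ + 5 * δ))
      hδ.ne').subset fun w hw => ?_
    simp only [hF, mem_compl_iff, mem_setOf_eq, not_le] at hw
    rw [mem_embMeshVertices_iff, mem_ball_zero_iff]
    exact hw
  -- far vertices are joined outside `G`
  have hFF : ∀ w₁ ∈ F, ∀ w₂ ∈ F, PathIn hexGraph Gᶜ w₁ w₂ := fun w₁ hw₁ w₂ hw₂ =>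
    pathIn_far hδ (by positivity) hGnorm hw₁ hw₂
  -- every vertex reaches the far set (greedy descent far below)
  have hreach : ∀ z : HexVertex, ∃ w ∈ F, PathIn hexGraph univ z w := by
    intro z
    obtain ⟨w, q, hw, -⟩ := exists_walk_down hδ z
      (L := R + ρ + 6 * δ + |((δ : ℂ) * hexCenter z).im|) (by positivity)
    refine ⟨w, ?_, pathIn_of_walk q fun _ _ => mem_univ _⟩
    have h1 : -((δ : ℂ) * hexCenter w).im ≤ ‖(δ : ℂ) * hexCenter w‖ :=
      (neg_le_abs _).trans (Complex.abs_im_le_norm _)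
    have h2 := le_abs_self ((δ : ℂ) * hexCenter z).im
    show R + ρ + 5 * δ ≤ ‖(δ : ℂ) * hexCenter w‖
    linarith
  obtain ⟨Λ, hGΛ, hsc, hconn, hmem⟩ := exists_fill hGG hfin hFF hreach
  -- escaping vertices are not in the fill
  have hesc : ∀ z : HexVertex, (∃ w : HexVertex, R + ρ + 5 * δ ≤ ‖(δ : ℂ) * hexCenter w‖ ∧
      PathIn hexGraph Sᶜ z w) → z ∉ Λ := by
    rintro z ⟨w, hw, hzw⟩ hzΛ
    exact (hmem z).1 hzΛ ⟨w, hw, hzw.mono (compl_subset_compl.2 hGS)⟩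
  refine ⟨Λ, hsc, hconn, fun z hz => hGΛ hz, fun z hz => ?_, fun z hz i hzi => ?_, hmem⟩
  · by_contra hzΩ
    exact hesc z (exists_pathIn_far_of_not_mem hE hEfr hΩR hfl hsep hρ hδ hδρ hS' hzΩ) hz
  · by_contra hrow
    push Not at hrow
    exact hesc z (exists_pathIn_far_of_row_lt hE hEfr hΩR hfl hsep hρ hδ hδρ hm hS' hSrow hzi hrow) hz

/-- **Exact rows near a window (greedy ascent).**  If the vertices of the target disc
`B̄(p i + iρ/4, ρ/8)` are in the `S`-component of `v₀`, so is every vertex of `B(p i, ρ/16)` of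
row `≥ m i` (`2000δ ≤ ρ`, up-faces of row `m i` strictly above the line): greedy ascent by `ρ/4`
runs through deep vertices (above the line inside the window, no lower than the up-faces of row
`m i`, with `70δ`-discs inside `B(p i, 5ρ/8)`) and ends in the target disc. -/
theorem pathIn_of_near_window {Ω : Set ℂ} {ρ δ : ℝ} {p : Fin 2 → ℂ} {m : Fin 2 → ℤ}
    {S : Set HexVertex}
    (hfl : ∀ i, Ω ∩ ball (p i) ρ = {z : ℂ | (p i).im < z.im} ∩ ball (p i) ρ)
    (hsep : 2 * ρ ≤ dist (p 0) (p 1)) (hρ : 0 < ρ) (hδ : 0 < δ) (hδρ : 2000 * δ ≤ ρ)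
    (hmlo : ∀ i, (p i).im < ((m i : ℝ) + 1 / 3) * (δ * (Real.sqrt 3 / 2)))
    (hS : ∀ u, u ∈ S ↔ ((δ : ℂ) * hexCenter u ∈ Ω ∧
      (∀ i, (δ : ℂ) * hexCenter u ∈ ball (p i) (ρ / 2) → m i ≤ u.1 1) ∧
      closedBall ((δ : ℂ) * hexCenter u) (70 * δ) ⊆ Ω ∪ ball (p 0) (5 * ρ / 8) ∪ ball (p 1) (5 * ρ / 8)))
    {v₀ : HexVertex} {i : Fin 2}
    (hK : ∀ z : HexVertex, (δ : ℂ) * hexCenter z ∈ closedBall (p i + (ρ / 4 : ℝ) * Complex.I) (ρ / 8) →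
      PathIn hexGraph S v₀ z)
    {v : HexVertex} (hvi : dist ((δ : ℂ) * hexCenter v) (p i) < ρ / 16) (hrow : m i ≤ v.1 1) :
    PathIn hexGraph S v₀ v := by
  have hsep' : ∀ j : Fin 2, j ≠ i → 2 * ρ ≤ dist (p i) (p j) := by
    intro j hij
    fin_cases i <;> fin_cases j
    · exact absurd rfl hij
    · exact hsep
    · rw [dist_comm]; exact hsep
    · exact absurd rfl hij
  have hvim : ((m i : ℝ) + 1 / 3) * (δ * (Real.sqrt 3 / 2)) ≤ ((δ : ℂ) * hexCenter v).im :=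
    (row_le_iff_im hδ (m i) v).1 hrow
  obtain ⟨z, q, hz, hq⟩ := exists_walk_up hδ v (L := ρ / 4) (by positivity)
  have hvz : PathIn hexGraph S v z := by
    refine pathIn_of_walk q fun u hu => (hS u).2 ?_
    obtain ⟨hup, hdu⟩ := hq u hu
    have hui : dist ((δ : ℂ) * hexCenter u) (p i) < 9 * ρ / 16 := by
      calc dist ((δ : ℂ) * hexCenter u) (p i)
          ≤ dist ((δ : ℂ) * hexCenter u) ((δ : ℂ) * hexCenter v) + dist ((δ : ℂ) * hexCenter v) (p i) :=
            dist_triangle _ _ _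
        _ < 2 * (ρ / 4) + ρ / 16 := add_lt_add_of_le_of_lt hdu hvi
        _ = 9 * ρ / 16 := by ring
    have huim : (p i).im < ((δ : ℂ) * hexCenter u).im := by linarith [hmlo i]
    have huΩ : (δ : ℂ) * hexCenter u ∈ Ω := by
      have : (δ : ℂ) * hexCenter u ∈ {z : ℂ | (p i).im < z.im} ∩ ball (p i) ρ :=
        ⟨huim, mem_ball.2 (hui.trans (by linarith))⟩
      rw [← hfl i] at this
      exact this.1
    refine ⟨huΩ, fun j hj => ?_, ?_⟩
    · -- the row condition: only the window `i` is near, and `u` is no lower than `v`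
      have hji : j = i := by
        by_contra hji
        have h1 := hsep' j hji
        have h2 : dist (p i) (p j) ≤ dist ((δ : ℂ) * hexCenter u) (p i) + dist ((δ : ℂ) * hexCenter u) (p j) :=
          dist_triangle_left _ _ _
        have h3 := mem_ball.1 hj
        linarith
      subst hji
      exact (row_le_iff_im hδ (m j) u).2 (hvim.trans hup)
    · -- the `70δ`-disc lies in `B(p i, 5ρ/8)`
      intro x hx
      have hxi : x ∈ ball (p i) (5 * ρ / 8) := by
        rw [mem_ball]
        calc dist x (p i) ≤ dist x ((δ : ℂ) * hexCenter u) + dist ((δ : ℂ) * hexCenter u) (p i) :=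
              dist_triangle _ _ _
          _ < 70 * δ + 9 * ρ / 16 := add_lt_add_of_le_of_lt (mem_closedBall.1 hx) hui
          _ ≤ 5 * ρ / 8 := by linarith
      fin_cases i
      · exact Or.inl (Or.inr hxi)
      · exact Or.inr hxi
  have hzK : (δ : ℂ) * hexCenter z ∈ closedBall (p i + (ρ / 4 : ℝ) * Complex.I) (ρ / 8) := by
    rw [mem_closedBall]
    calc dist ((δ : ℂ) * hexCenter z) (p i + (ρ / 4 : ℝ) * Complex.I)
        ≤ dist ((δ : ℂ) * hexCenter z) ((δ : ℂ) * hexCenter v + (ρ / 4 : ℝ) * Complex.I) +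
            dist ((δ : ℂ) * hexCenter v + (ρ / 4 : ℝ) * Complex.I) (p i + (ρ / 4 : ℝ) * Complex.I) :=
          dist_triangle _ _ _
      _ ≤ δ + ρ / 16 := by
          refine add_le_add hz ?_
          rw [dist_add_right]; exact hvi.le
      _ ≤ ρ / 8 := by linarith
  exact (hK z hzK).trans hvz.symm

/-- **Vertices with a deep disc in the domain are deep.**  If `B̄(δ c_u, r) ⊆ Ω` with `70δ ≤ r`,
`r < ρ/2` and `(m i + 1/3) δ√3/2 ≤ im (p i) + r` for both `i`, then `u ∈ S` (inside a window the
disc would otherwise reach the line `im = im (p i)`, which misses `Ω`). -/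
theorem mem_deep_of_closedBall_subset {Ω : Set ℂ} {ρ δ r : ℝ} {p : Fin 2 → ℂ} {m : Fin 2 → ℤ}
    {S : Set HexVertex}
    (hfl : ∀ i, Ω ∩ ball (p i) ρ = {z : ℂ | (p i).im < z.im} ∩ ball (p i) ρ)
    (hδ : 0 < δ) (hr : 70 * δ ≤ r) (hrρ : r < ρ / 2)
    (hmr : ∀ i, ((m i : ℝ) + 1 / 3) * (δ * (Real.sqrt 3 / 2)) ≤ (p i).im + r)
    (hS : ∀ u, u ∈ S ↔ ((δ : ℂ) * hexCenter u ∈ Ω ∧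
      (∀ i, (δ : ℂ) * hexCenter u ∈ ball (p i) (ρ / 2) → m i ≤ u.1 1) ∧
      closedBall ((δ : ℂ) * hexCenter u) (70 * δ) ⊆ Ω ∪ ball (p 0) (5 * ρ / 8) ∪ ball (p 1) (5 * ρ / 8)))
    {u : HexVertex} (hu : closedBall ((δ : ℂ) * hexCenter u) r ⊆ Ω) : u ∈ S := by
  have hr0 : 0 ≤ r := by linarith
  refine (hS u).2 ⟨hu (mem_closedBall_self hr0), fun i hi => ?_,
    (closedBall_subset_closedBall hr).trans (hu.trans fun x hx => Or.inl (Or.inl hx))⟩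
  -- inside the window the disc stays above the line, so `u` is at height `≥ im (p i) + r`
  refine (row_le_iff_im hδ (m i) u).2 ((hmr i).trans ?_)
  by_contra hlt
  push Not at hlt
  -- the point of the disc straight below `δ c_u` on the line `im = im (p i)`
  set x : ℂ := ⟨((δ : ℂ) * hexCenter u).re, (p i).im⟩ with hx
  have huim : (p i).im < ((δ : ℂ) * hexCenter u).im :=
    im_lt_of_flat (hfl i) (ball_subset_ball (by linarith) hi) (hu (mem_closedBall_self hr0))
  have hxu : dist x ((δ : ℂ) * hexCenter u) = ((δ : ℂ) * hexCenter u).im - (p i).im := by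
    rw [dist_comm, dist_eq_norm, Complex.norm_def, Complex.normSq_apply]
    simp only [hx, Complex.sub_re, Complex.sub_im, sub_self, mul_zero, zero_add]
    rw [Real.sqrt_mul_self (by linarith)]
  have hxball : x ∈ closedBall ((δ : ℂ) * hexCenter u) r := by
    rw [mem_closedBall, hxu]; linarith
  have hxΩ : x ∈ Ω := hu hxball
  have hxi : x ∈ ball (p i) ρ := by
    rw [mem_ball]
    calc dist x (p i) ≤ dist x ((δ : ℂ) * hexCenter u) + dist ((δ : ℂ) * hexCenter u) (p i) :=
          dist_triangle _ _ _
      _ < r + ρ / 2 := by rw [hxu]; linarith [mem_ball.1 hi]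
      _ ≤ ρ := by linarith
  have := im_lt_of_flat (hfl i) hxi hxΩ
  simp [hx] at this

/-- **Registered sub-goal `stub_carvedReduction_twoPieceInner`** (crux item stmt-CriticalPhenomena-14005,
stub 5a4′ `stub_carvedReduction_squeeze`, piece (G4′c) INNER VERTEX DOMAIN OF A TWO-PIECE FLAT
DOMAIN AT A FIXED MESH): registry form of `exists_twoPieceInner`. -/
theorem stub_carvedReduction_twoPieceInner :
    ∀ (Ω : Set ℂ) (ρ δ R : ℝ) (p : Fin 2 → ℂ) (m : Fin 2 → ℤ) (S : Set HexVertex) (v₀ : HexVertex),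
      IsConnected (closure Ω)ᶜ → frontier (closure Ω)ᶜ = frontier Ω → (∀ z ∈ Ω, ‖z‖ < R) →
      (∀ i, Ω ∩ ball (p i) ρ = {z : ℂ | (p i).im < z.im} ∩ ball (p i) ρ) →
      2 * ρ ≤ dist (p 0) (p 1) → 0 < ρ → 0 < δ → 1000 * δ ≤ ρ →
      (∀ i, ((m i : ℝ) + 1 / 3) * (δ * (Real.sqrt 3 / 2)) ≤ (p i).im + ρ / 16) →
      (∀ u, u ∈ S ↔ ((δ : ℂ) * hexCenter u ∈ Ω ∧
        (∀ i, (δ : ℂ) * hexCenter u ∈ ball (p i) (ρ / 2) → m i ≤ u.1 1) ∧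
        closedBall ((δ : ℂ) * hexCenter u) (70 * δ) ⊆ Ω ∪ ball (p 0) (5 * ρ / 8) ∪ ball (p 1) (5 * ρ / 8))) →
      ∃ Λ : Finset HexVertex, hexDomainSimplyConnected Λ ∧
        (hexGraph.induce (↑Λ : Set HexVertex)).Preconnected ∧
        (∀ z : HexVertex, PathIn hexGraph S v₀ z → z ∈ Λ) ∧
        (∀ z ∈ Λ, (δ : ℂ) * hexCenter z ∈ Ω) ∧
        (∀ z ∈ Λ, ∀ i, dist ((δ : ℂ) * hexCenter z) (p i) < ρ / 16 → m i ≤ z.1 1) ∧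
        (∀ z : HexVertex, z ∈ Λ ↔ ¬ ∃ w : HexVertex, R + ρ + 5 * δ ≤ ‖(δ : ℂ) * hexCenter w‖ ∧
          PathIn hexGraph {x | PathIn hexGraph S v₀ x}ᶜ z w) :=
  fun _ _ _ _ _ _ _ v₀ hE hEfr hΩR hfl hsep hρ hδ hδρ hm hS =>
    exists_twoPieceInner hE hEfr hΩR hfl hsep hρ hδ hδρ hm hS v₀

end Summit.CriticalPhenomena.SAWScalingLimit.Theorems.ObservableToSLER.Squeeze

end
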